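/-
Copyright (c) 2026 the pub-hodgecm-mathlib formalisation cell (harness21).  Prover seat hodgecm-mathlib-LH4-p12 (g7), req620 Track A «(D-RAM) FOUR-FRAME», line LH4
(STAGE-1b tier-0 regular row, (L-sq) labelled trunk brick (d) PART 1: the valuation letters of the square token of record and the SPLIT cells (core ∕ T1 ∕ T2 ∕ T3) of the
labelled trunk IN THE CURRENCY OF `SqLabelledBoxSum` (this seat's DEFS leaf) — i.e. with the label indicator DISCHARGED under the derived fence ★ p859917).  2026-09-04.
-/
import Summits.HodgeConjecture.HodgeConjecture.Theorems.F0P3cDyRamLabelledKappaSplitSockets     -- ★ p859711 (this seat): the labelled split κ-sockets (label-generic)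
import Summits.HodgeConjecture.HodgeConjecture.Theorems.F0P3cDyRamElementDatumParity           -- ★ `isoceles_of_isElementDatum`, `depth_mod_two_eq_of_isElementDatum`
import HarnessLib

/-!
# Crux `H413`, line LH4 «(D-RAM) FOUR-FRAME» — (d) PART 1: THE SQUARE TOKEN'S LETTERS AND THE SPLIT CELLS IN BOX-SUM CURRENCY

The labelled trunk `hTrunk` of ★ p859650 is assembled (★ p857082's steps) from the partition ★ p859743, the per-stratum labelled κ-cells, and the truncated box-sum
`SqLabelledBoxSum` (this seat's DEFS leaf, proved by LH4-p10 (g6)).  The box-sum consumes the cells in ★ p856906's currency: `hT1 : v(0,s,s) = [i = 0][2d ≤ s][2∣s][s ≤ n₁]·ω·q^{s∕2}`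
etc. — WITHOUT a label indicator on the split cells (the (T-box | sq) SPEC: under the fence `nᵢ ≥ 2d − 1` the square label of record `Q = LatticeInLevel ϖ ℓ (diag((α−1)², (β−1)², 0))`,
`ℓ + 1 = d % 2 + 2d` (`ℓ = mstarOfRecord d`), never cuts a split cell that carries κ-mass).  This file discharges the indicator: §1 the valuation letters of the token
(`|e₀| = |ϖ|^{2n₂}`, `|e₁| = |ϖ|^{2n₁}`, `e₂ = 0`, `|e₁ − e₀| ≤ |ϖ|^{2·min(n₁,n₂)}`, and `≤ |ϖ|^{n₂+n₃+1}` on the type `n₁ = n₂ < n₃`), §2 the four split cells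
`Σᶠ_{M ∈ stratum(a), Q M} κ₀,ᵢ(M)·w(M)` EQUAL TO ★ p856906's `hcore ∕ hT1 ∕ hT2 ∕ hT3` right-hand sides (★ p859711 + §1 + the fence arithmetic).

HONEST LABEL: helper lane (`--supports stmt-HodgeConjecture-24833`), count-neutral; per-stratum census identities; pays no tier-0 row (T₊∕T₋∕reg OPEN; labelled trunk OPEN =
(c) `SqLabelledBoxSum` (LH4-p10) + (d) PARTS 2–3 (glued ∕ H cells, assembly)); HC_CM is proved only modulo the 7 printed citations (2 remaining named inputs: hLiu418 =
stmt-HodgeConjecture-24832, h413 = stmt-HodgeConjecture-24833) until rung 0 closes.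

## References (NEVER `[KR2]`)
* [Kottwitz1986BaseChangeUnits] R. E. Kottwitz, *Base change for unit elements of Hecke algebras*, Compositio Math. 60 (1986), §1 pp. 240–241.
* [Rogawski1990] J. D. Rogawski, *Automorphic Representations of Unitary Groups in Three Variables*, Ann. of Math. Stud. 123 (1990), §4.9 Prop. 4.9.1 (a) p. 55.
* [Serre1979] J.-P. Serre, *Local Fields*, GTM 67 (1979), Ch. V §3.
-/

set_option autoImplicit false

noncomputable section

namespace Summit.HodgeConjecture.HodgeConjecture.Cruxes.H413.F0P3cDyRamSqLabelledCellsSplit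

open Matrix
open Literature.NumberTheory.Automorphic Literature.NumberTheory.Automorphic.HermitianLattice
open Literature.NumberTheory.Automorphic.UnitaryLatticeTree Literature.NumberTheory.Automorphic.UnitaryThreeFourFrame
open Literature.NumberTheory.LocalFields Literature.NumberTheory.LocalFields.WildQuadraticDatum
open Summit.HodgeConjecture.HodgeConjecture.Cruxes.H413.F0P3cDyRamDiagonalTorusDefs
open Summit.HodgeConjecture.HodgeConjecture.Cruxes.H413.F0P3cDyRamDiagonalStrataDefs
open Summit.HodgeConjecture.HodgeConjecture.Cruxes.H413.F0P3cDyRamDiagonalKappaCountDefs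
open Summit.HodgeConjecture.HodgeConjecture.Cruxes.H413.F0P3cDyRamFourFrameCensusDefs
open Summit.HodgeConjecture.HodgeConjecture.Cruxes.H413.F0P3cDyRamElementDatumParity (isoceles_of_isElementDatum depth_mod_two_eq_of_isElementDatum)
open Summit.HodgeConjecture.HodgeConjecture.Cruxes.H413.F0P3cDyRamLabelledKappaSplitSockets
open scoped Valued WithZero Matrix MatrixGroups

/-! ## §1  The valuation letters of the square token `e = ((α−1)², (β−1)², 0)` -/

section Letters

variable {K : Type} [Field K] [Valued K ℤᵐ⁰]

/-- From `|ϖ|^a ≤ |ϖ|^b` with `|ϖ| < 1`: `b ≤ a`. -/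
theorem le_of_pow_le_pow {ϖ : K} (hϖ0 : 0 < Valued.v ϖ) (hϖ1 : Valued.v ϖ < 1) {a b : ℕ} (h : Valued.v ϖ ^ a ≤ Valued.v ϖ ^ b) : b ≤ a := by
  by_contra hlt
  exact absurd h (not_le.2 (pow_lt_pow_right_of_lt_one₀ hϖ0 hϖ1 (not_le.1 hlt)))

/-- The three entries of the square token: `|e₀| = |ϖ|^{2n₂}`, `|e₁| = |ϖ|^{2n₁}`, `e₂ = 0`. [cite: Rogawski1990, §4.9 Prop. 4.9.1 (a) p. 55] -/
theorem sqToken_entries {ϖ α β : K} {n₁ n₂ : ℕ} (h₁ : Valued.v (β - 1) = Valued.v ϖ ^ n₁) (h₂ : Valued.v (α - 1) = Valued.v ϖ ^ n₂) :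
    Valued.v ((![(α - 1) * (α - 1), (β - 1) * (β - 1), 0] : Fin 3 → K) 0) = Valued.v ϖ ^ (2 * n₂) ∧
      Valued.v ((![(α - 1) * (α - 1), (β - 1) * (β - 1), 0] : Fin 3 → K) 1) = Valued.v ϖ ^ (2 * n₁) ∧
        (![(α - 1) * (α - 1), (β - 1) * (β - 1), 0] : Fin 3 → K) 2 = 0 := by
  simp only [Matrix.cons_val_zero, Matrix.cons_val_one, Matrix.cons_val_two, Matrix.head_cons, Matrix.tail_cons, map_mul, h₁, h₂, ← pow_add,
    two_mul, and_self]

/-- The differences: `|e₂ − e₀| = |ϖ|^{2n₂}`, `|e₂ − e₁| = |ϖ|^{2n₁}`, and `|e₁ − e₀| ≤ |ϖ|^{2·min(n₁,n₂)}` (ultrametric). [cite: Serre1979, Ch. V §3] -/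
theorem sqToken_differences_le {ϖ α β : K} {n₁ n₂ : ℕ} (hϖ1 : Valued.v ϖ ≤ 1) (h₁ : Valued.v (β - 1) = Valued.v ϖ ^ n₁) (h₂ : Valued.v (α - 1) = Valued.v ϖ ^ n₂) :
    Valued.v ((![(α - 1) * (α - 1), (β - 1) * (β - 1), 0] : Fin 3 → K) 2 - (![(α - 1) * (α - 1), (β - 1) * (β - 1), 0] : Fin 3 → K) 0) =
        Valued.v ϖ ^ (2 * n₂) ∧
      Valued.v ((![(α - 1) * (α - 1), (β - 1) * (β - 1), 0] : Fin 3 → K) 2 - (![(α - 1) * (α - 1), (β - 1) * (β - 1), 0] : Fin 3 → K) 1) =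
        Valued.v ϖ ^ (2 * n₁) ∧
      Valued.v ((![(α - 1) * (α - 1), (β - 1) * (β - 1), 0] : Fin 3 → K) 1 - (![(α - 1) * (α - 1), (β - 1) * (β - 1), 0] : Fin 3 → K) 0) ≤
        Valued.v ϖ ^ (2 * min n₁ n₂) := by
  simp only [Matrix.cons_val_zero, Matrix.cons_val_one, Matrix.cons_val_two, Matrix.head_cons, Matrix.tail_cons, zero_sub, Valuation.map_neg, map_mul,
    h₁, h₂, ← pow_add, two_mul, true_and]
  refine (Valuation.map_sub _ _ _).trans (max_le ?_ ?_)
  · rw [map_mul, h₁, ← pow_add]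
    exact pow_le_pow_right_of_le_one' hϖ1 (by omega)
  · rw [map_mul, h₂, ← pow_add]
    exact pow_le_pow_right_of_le_one' hϖ1 (by omega)

/-- **THE THIRD LETTER ON THE TYPE `n₁ = n₂ < n₃`**: `|(β−1)² − (α−1)²| = |β − α|·|2(α−1) + (β−α)| ≤ |ϖ|^{n₃}·max(|2|·|ϖ|^{n₂}, |ϖ|^{n₃}) ≤ |ϖ|^{n₂ + n₃ + 1}` when `|2| ≤ |ϖ|`
and `n₂ + 1 ≤ n₃` (the factor `2` — no cancellation letter is needed). [cite: Serre1979, Ch. V §3] -/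
theorem sqToken_third_le_typeC {ϖ α β : K} {n₂ n₃ : ℕ} (hϖ1 : Valued.v ϖ ≤ 1) (h2 : Valued.v (2 : K) ≤ Valued.v ϖ)
    (h₂ : Valued.v (α - 1) = Valued.v ϖ ^ n₂) (h₃ : Valued.v (α - β) = Valued.v ϖ ^ n₃) (h23 : n₂ + 1 ≤ n₃) :
    Valued.v ((![(α - 1) * (α - 1), (β - 1) * (β - 1), 0] : Fin 3 → K) 1 - (![(α - 1) * (α - 1), (β - 1) * (β - 1), 0] : Fin 3 → K) 0) ≤
      Valued.v ϖ ^ (n₂ + n₃ + 1) := by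
  simp only [Matrix.cons_val_zero, Matrix.cons_val_one]
  rw [show (β - 1) * (β - 1) - (α - 1) * (α - 1) = (β - α) * (2 * (α - 1) + (β - α)) by ring, map_mul, Valuation.map_sub_swap, h₃,
    show n₂ + n₃ + 1 = n₃ + (n₂ + 1) by ring, pow_add]
  refine mul_le_mul_right ((Valuation.map_add _ _ _).trans (max_le ?_ ?_)) _
  · rw [map_mul, h₂, pow_succ']
    exact mul_le_mul_left h2 _
  · rw [Valuation.map_sub_swap, h₃]
    exact pow_le_pow_right_of_le_one' hϖ1 h23

end Letters

/-! ## §2  The split cells of the square label in box-sum currency -/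

section Split

variable {K : Type} [Field K] [Valued K ℤᵐ⁰] [Fintype 𝓀[K]] [CompleteSpace K] {σ : K →+* K} {ϖ : K} {d t : ℕ} {α β : K} {N₀ n₁ n₂ n₃ : ℕ}
  {T : GL (Fin 3) K}

/-- **SPLIT CELL core** (any label): `0`. [cite: Kottwitz1986BaseChangeUnits, §1 pp. 240–241] -/
theorem cell_core (hD : IsRamifiedQuadraticDatum σ ϖ d t) (hE : IsElementDatum σ ϖ N₀ α β n₁ n₂ n₃)
    (hT : (T : Matrix (Fin 3) (Fin 3) K) = Matrix.diagonal ![α, β, 1]) (i : Fin 3) (ℓ : ℕ) :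
    ∑ᶠ M ∈ {M | M ∈ stratum σ ϖ T ![0, 0, 0] ∧ LatticeInLevel ϖ ℓ (Matrix.diagonal ![(α - 1) * (α - 1), (β - 1) * (β - 1), 0]) M},
      (kappaCount σ ϖ 0 i M : ℚ) * stabiliserWeight σ M = 0 :=
  finsum_kappaCount_mul_stabiliserWeight_stratum_core_sep_latticeInLevel hD hE hT i ℓ _

/-- **SPLIT CELL T1 `(0,s,s)` IN BOX-SUM CURRENCY**: under the fence `2d ≤ n₁ + 1 ∧ 2d ≤ n₂ + 1` and `ℓ + 1 = d % 2 + 2d`, the square label never cuts a T1 cell carrying κ-mass: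
`Σᶠ_{M ∈ T1(s), Q M} κ₀,ᵢ·w = [i = 0][2d ≤ s][2 ∣ s][s ≤ n₁]·ω·q^{s∕2}` — ★ p856906's `hT1` right-hand side verbatim.  (★ p859711 gives `[reads(s)]·(that)`; the reads
`2n₂, 2n₁ ≥ ℓ` and `2n₁ ≥ ℓ + s` follow from `s ≤ n₁`, `2 ∣ s`, the parity `n₁ ≡ d`, and the fence.) [cite: Kottwitz1986BaseChangeUnits, §1 pp. 240–241] [cite: Rogawski1990, §4.9 Prop. 4.9.1 (a) p. 55] -/
theorem cell_T1 (hD : IsRamifiedQuadraticDatum σ ϖ d t) (hE : IsElementDatum σ ϖ N₀ α β n₁ n₂ n₃) (hN₀ : d ≤ N₀)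
    (hT : (T : Matrix (Fin 3) (Fin 3) K) = Matrix.diagonal ![α, β, 1]) (hfence : 2 * d ≤ n₁ + 1 ∧ 2 * d ≤ n₂ + 1 ∧ 2 * d ≤ n₃ + 1)
    {ℓ : ℕ} (hℓ : ℓ + 1 = d % 2 + 2 * d) (s : ℕ) (hs : 1 ≤ s) (i : Fin 3) :
    ∑ᶠ M ∈ {M | M ∈ stratum σ ϖ T ![0, s, s] ∧ LatticeInLevel ϖ ℓ (Matrix.diagonal ![(α - 1) * (α - 1), (β - 1) * (β - 1), 0]) M},
        (kappaCount σ ϖ 0 i M : ℚ) * stabiliserWeight σ M =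
      if i = 0 ∧ 2 * d ≤ s ∧ 2 ∣ s ∧ s ≤ n₁ then (normSign σ (-1 : K) : ℚ) * (Fintype.card 𝓀[K] : ℚ) ^ (s / 2) else 0 := by
  obtain ⟨-, -, hϖ, -, -, -, -⟩ := id hD
  obtain ⟨-, -, -, -, -, h₁, h₂, -, -, -, -⟩ := id hE
  have hϖ1 : Valued.v ϖ ≤ 1 := by rw [hϖ, ← WithZero.exp_zero, WithZero.exp_le_exp]; norm_num
  obtain ⟨hp1, -, -⟩ := depth_mod_two_eq_of_isElementDatum hD hE hN₀
  obtain ⟨he0, he1, he2⟩ := sqToken_entries (α := α) (β := β) h₁ h₂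
  obtain ⟨-, he21, -⟩ := sqToken_differences_le (α := α) (β := β) hϖ1 h₁ h₂
  rw [finsum_kappaCount_mul_stabiliserWeight_stratum_T1_sep_latticeInLevel hD hE hT s hs i ℓ _]
  by_cases hX : i = 0 ∧ 2 * d ≤ s ∧ 2 ∣ s ∧ s ≤ n₁
  · obtain ⟨-, -, hs2, hsn⟩ := hX
    have hread : (Valued.v ((![(α - 1) * (α - 1), (β - 1) * (β - 1), 0] : Fin 3 → K) 0) ≤ Valued.v ϖ ^ ℓ ∧
        Valued.v ((![(α - 1) * (α - 1), (β - 1) * (β - 1), 0] : Fin 3 → K) 1) ≤ Valued.v ϖ ^ ℓ ∧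
        Valued.v ((![(α - 1) * (α - 1), (β - 1) * (β - 1), 0] : Fin 3 → K) 2) ≤ Valued.v ϖ ^ ℓ) ∧
        Valued.v ((![(α - 1) * (α - 1), (β - 1) * (β - 1), 0] : Fin 3 → K) 2 - (![(α - 1) * (α - 1), (β - 1) * (β - 1), 0] : Fin 3 → K) 1) ≤
          Valued.v ϖ ^ (ℓ + s) := by
      refine ⟨⟨?_, ?_, ?_⟩, ?_⟩
      · rw [he0]; exact pow_le_pow_right_of_le_one' hϖ1 (by omega)
      · rw [he1]; exact pow_le_pow_right_of_le_one' hϖ1 (by omega)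
      · rw [he2, map_zero]; exact zero_le
      · rw [he21]; exact pow_le_pow_right_of_le_one' hϖ1 (by omega)
    rw [if_pos hread]
  · rw [if_neg hX]
    split_ifs <;> rfl

/-- **SPLIT CELL T2 `(s,0,s)` IN BOX-SUM CURRENCY**: `= [i = 1][2d ≤ s][2 ∣ s][s ≤ n₂]·ω·q^{s∕2}` (★ p856906 `hT2` verbatim; the read `2n₂ ≥ ℓ + s` from `s ≤ n₂`, parity, fence).
[cite: Kottwitz1986BaseChangeUnits, §1 pp. 240–241] [cite: Rogawski1990, §4.9 Prop. 4.9.1 (a) p. 55] -/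
theorem cell_T2 (hD : IsRamifiedQuadraticDatum σ ϖ d t) (hE : IsElementDatum σ ϖ N₀ α β n₁ n₂ n₃) (hN₀ : d ≤ N₀)
    (hT : (T : Matrix (Fin 3) (Fin 3) K) = Matrix.diagonal ![α, β, 1]) (hfence : 2 * d ≤ n₁ + 1 ∧ 2 * d ≤ n₂ + 1 ∧ 2 * d ≤ n₃ + 1)
    {ℓ : ℕ} (hℓ : ℓ + 1 = d % 2 + 2 * d) (s : ℕ) (hs : 1 ≤ s) (i : Fin 3) :
    ∑ᶠ M ∈ {M | M ∈ stratum σ ϖ T ![s, 0, s] ∧ LatticeInLevel ϖ ℓ (Matrix.diagonal ![(α - 1) * (α - 1), (β - 1) * (β - 1), 0]) M},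
        (kappaCount σ ϖ 0 i M : ℚ) * stabiliserWeight σ M =
      if i = 1 ∧ 2 * d ≤ s ∧ 2 ∣ s ∧ s ≤ n₂ then (normSign σ (-1 : K) : ℚ) * (Fintype.card 𝓀[K] : ℚ) ^ (s / 2) else 0 := by
  obtain ⟨-, -, hϖ, -, -, -, -⟩ := id hD
  obtain ⟨-, -, -, -, -, h₁, h₂, -, -, -, -⟩ := id hE
  have hϖ1 : Valued.v ϖ ≤ 1 := by rw [hϖ, ← WithZero.exp_zero, WithZero.exp_le_exp]; norm_num
  obtain ⟨-, hp2, -⟩ := depth_mod_two_eq_of_isElementDatum hD hE hN₀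
  obtain ⟨he0, he1, he2⟩ := sqToken_entries (α := α) (β := β) h₁ h₂
  obtain ⟨he20, -, -⟩ := sqToken_differences_le (α := α) (β := β) hϖ1 h₁ h₂
  rw [finsum_kappaCount_mul_stabiliserWeight_stratum_T2_sep_latticeInLevel hD hE hT s hs i ℓ _]
  by_cases hX : i = 1 ∧ 2 * d ≤ s ∧ 2 ∣ s ∧ s ≤ n₂
  · obtain ⟨-, -, hs2, hsn⟩ := hX
    have hread : (Valued.v ((![(α - 1) * (α - 1), (β - 1) * (β - 1), 0] : Fin 3 → K) 0) ≤ Valued.v ϖ ^ ℓ ∧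
        Valued.v ((![(α - 1) * (α - 1), (β - 1) * (β - 1), 0] : Fin 3 → K) 1) ≤ Valued.v ϖ ^ ℓ ∧
        Valued.v ((![(α - 1) * (α - 1), (β - 1) * (β - 1), 0] : Fin 3 → K) 2) ≤ Valued.v ϖ ^ ℓ) ∧
        Valued.v ((![(α - 1) * (α - 1), (β - 1) * (β - 1), 0] : Fin 3 → K) 2 - (![(α - 1) * (α - 1), (β - 1) * (β - 1), 0] : Fin 3 → K) 0) ≤
          Valued.v ϖ ^ (ℓ + s) := by
      refine ⟨⟨?_, ?_, ?_⟩, ?_⟩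
      · rw [he0]; exact pow_le_pow_right_of_le_one' hϖ1 (by omega)
      · rw [he1]; exact pow_le_pow_right_of_le_one' hϖ1 (by omega)
      · rw [he2, map_zero]; exact zero_le
      · rw [he20]; exact pow_le_pow_right_of_le_one' hϖ1 (by omega)
    rw [if_pos hread]
  · rw [if_neg hX]
    split_ifs <;> rfl

/-- **SPLIT CELL T3 `(s,s,0)` IN BOX-SUM CURRENCY**: `= [i = 2][2d ≤ s][2 ∣ s][s ≤ n₃]·ω·q^{s∕2}` (★ p856906 `hT3` verbatim).  The read `|(β−1)² − (α−1)²| ≤ |ϖ|^{ℓ+s}`: off the type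
`n₁ = n₂ < n₃` from `|·| ≤ |ϖ|^{2·min(n₁,n₂)}` and `s ≤ n₃ = min`; on it from §1's `|·| ≤ |ϖ|^{n₂+n₃+1}` (the factor `2`, `|2| ≤ |ϖ|`).
[cite: Kottwitz1986BaseChangeUnits, §1 pp. 240–241] [cite: Rogawski1990, §4.9 Prop. 4.9.1 (a) p. 55] -/
theorem cell_T3 (hD : IsRamifiedQuadraticDatum σ ϖ d t) (h2 : Valued.v (2 : K) < 1) (hE : IsElementDatum σ ϖ N₀ α β n₁ n₂ n₃) (hN₀ : d ≤ N₀)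
    (hT : (T : Matrix (Fin 3) (Fin 3) K) = Matrix.diagonal ![α, β, 1]) (hfence : 2 * d ≤ n₁ + 1 ∧ 2 * d ≤ n₂ + 1 ∧ 2 * d ≤ n₃ + 1)
    {ℓ : ℕ} (hℓ : ℓ + 1 = d % 2 + 2 * d) (s : ℕ) (hs : 1 ≤ s) (i : Fin 3) :
    ∑ᶠ M ∈ {M | M ∈ stratum σ ϖ T ![s, s, 0] ∧ LatticeInLevel ϖ ℓ (Matrix.diagonal ![(α - 1) * (α - 1), (β - 1) * (β - 1), 0]) M},
        (kappaCount σ ϖ 0 i M : ℚ) * stabiliserWeight σ M =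
      if i = 2 ∧ 2 * d ≤ s ∧ 2 ∣ s ∧ s ≤ n₃ then (normSign σ (-1 : K) : ℚ) * (Fintype.card 𝓀[K] : ℚ) ^ (s / 2) else 0 := by
  obtain ⟨-, -, hϖ, -, -, -, h2t⟩ := id hD
  obtain ⟨-, -, -, -, -, h₁, h₂, h₃, -, -, -⟩ := id hE
  have hϖ1 : Valued.v ϖ ≤ 1 := by rw [hϖ, ← WithZero.exp_zero, WithZero.exp_le_exp]; norm_num
  have hϖ0 : 0 < Valued.v ϖ := by rw [hϖ]; exact WithZero.exp_pos
  have hϖlt : Valued.v ϖ < 1 := by rw [hϖ, ← WithZero.exp_zero, WithZero.exp_lt_exp]; norm_num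
  obtain ⟨hp1, hp2, hp3⟩ := depth_mod_two_eq_of_isElementDatum hD hE hN₀
  have hiso := isoceles_of_isElementDatum hD hE
  obtain ⟨he0, he1, he2⟩ := sqToken_entries (α := α) (β := β) h₁ h₂
  obtain ⟨-, -, he10⟩ := sqToken_differences_le (α := α) (β := β) hϖ1 h₁ h₂
  -- `|2| ≤ |ϖ|`: `|2| = |ϖ|^t < 1` forces `t ≥ 1`
  have ht1 : 1 ≤ t := by
    by_contra ht
    have ht0 : t = 0 := by omega
    rw [h2t, ht0, pow_zero] at h2
    exact absurd h2 (lt_irrefl 1)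
  have h2ϖ : Valued.v (2 : K) ≤ Valued.v ϖ := by
    rw [h2t]
    calc Valued.v ϖ ^ t ≤ Valued.v ϖ ^ 1 := pow_le_pow_right_of_le_one' hϖ1 ht1
      _ = Valued.v ϖ := pow_one _
  rw [finsum_kappaCount_mul_stabiliserWeight_stratum_T3_sep_latticeInLevel hD hE hT s hs i ℓ _]
  by_cases hX : i = 2 ∧ 2 * d ≤ s ∧ 2 ∣ s ∧ s ≤ n₃
  · obtain ⟨-, -, hs2, hsn⟩ := hX
    have hthird : Valued.v ((![(α - 1) * (α - 1), (β - 1) * (β - 1), 0] : Fin 3 → K) 1 - (![(α - 1) * (α - 1), (β - 1) * (β - 1), 0] : Fin 3 → K) 0) ≤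
        Valued.v ϖ ^ (ℓ + s) := by
      by_cases hC : n₁ = n₂ ∧ n₂ < n₃
      · exact (sqToken_third_le_typeC hϖ1 h2ϖ h₂ h₃ (by omega)).trans (pow_le_pow_right_of_le_one' hϖ1 (by omega))
      · have hmin : n₃ ≤ min n₁ n₂ := by
          rcases hiso with ⟨h12, h13⟩ | ⟨h13, h12⟩ | ⟨h23, h21⟩
          · have hn : ¬ n₂ < n₃ := fun h => hC ⟨h12, h⟩
            exact le_min (by omega) (by omega)
          · exact le_min (by omega) (by omega)
          · exact le_min (by omega) (by omega)
        exact he10.trans (pow_le_pow_right_of_le_one' hϖ1 (by omega))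
    have hread : (Valued.v ((![(α - 1) * (α - 1), (β - 1) * (β - 1), 0] : Fin 3 → K) 0) ≤ Valued.v ϖ ^ ℓ ∧
        Valued.v ((![(α - 1) * (α - 1), (β - 1) * (β - 1), 0] : Fin 3 → K) 1) ≤ Valued.v ϖ ^ ℓ ∧
        Valued.v ((![(α - 1) * (α - 1), (β - 1) * (β - 1), 0] : Fin 3 → K) 2) ≤ Valued.v ϖ ^ ℓ) ∧
        Valued.v ((![(α - 1) * (α - 1), (β - 1) * (β - 1), 0] : Fin 3 → K) 1 - (![(α - 1) * (α - 1), (β - 1) * (β - 1), 0] : Fin 3 → K) 0) ≤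
          Valued.v ϖ ^ (ℓ + s) := by
      refine ⟨⟨?_, ?_, ?_⟩, hthird⟩
      · rw [he0]; exact pow_le_pow_right_of_le_one' hϖ1 (by omega)
      · rw [he1]; exact pow_le_pow_right_of_le_one' hϖ1 (by omega)
      · rw [he2, map_zero]; exact zero_le
    rw [if_pos hread]
  · rw [if_neg hX]
    split_ifs <;> rfl

end Split

end Summit.HodgeConjecture.HodgeConjecture.Cruxes.H413.F0P3cDyRamSqLabelledCellsSplit

end
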